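import Literature.NumberTheory.LFunctions.Zhang2022.ObjectiveTwinEllFrameK0

/-!
# Zhang (2022) design-space objective, twin part 9: the limit value of the `K₀` main term along the
# regime and the kernel THRESHOLD the first-order dictionary term must beat

Y. Zhang, *Discrete mean estimates and the Landau–Siegel zero*, arXiv:2211.02515v1 (2022)
[Zhang2022LandauSiegel] — an unrefereed manuscript under adjudication. **This file SEARCHES and TYPES; it
makes no claim about Landau–Siegel zeros, about Theorems 1–2 of the manuscript, or about a repaired (2.32),
until a kernel theorem says so.** LANDAU–SIEGEL programme, cell `landau-siegel`, §A Lean twin; companion of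
`ObjectiveTwinEllFrameK0` (B-ell block «K₀», endgame `EllRegime.theorem1_of_ellDictK0`).

Part 8 proved that the closing hypothesis `hneg` of the `K₀` endgame forces `(G₀ + λG₁)/A + K/A² < 0`. Here the
bound is made QUANTITATIVE for the manuscript's shifts `k = (1,2,3)`: along the explicit regime records
`regimeRecord A D` the main term `F_{ℓ(P)}(rescale (L_M/L_R) (expComb (1,2,3) u))` converges, as `D → ∞`, to

  `phiLim A u = ((A+1)/A)·ellFormQ (A/(A+½)) (−u₀) u₁ (−u₂)`            (`tendsto_mainTerm_regimeRecord_k123`)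

(`ℓ(P)·(L_M/L_R) → A/(A+½) = 1 − 1/(2A+1)`, `L_M/L_R → A/(A+1)`; `Scales.tendsto_ellRatio/tendsto_shrinkRatio` of
`EllRegimeStatements`, the pencil `ellFormQ` of `ObjectiveTwinEllKernelForm`, the closed form
`mainTermFormEll_rescale_expComb_k123` of part 8), and therefore

  `hneg ⇒ ∀ |λ| ≤ Λ, (G₀ + λG₁)/A + K/A² ≤ −phiLim A u`                   (`dict_le_neg_phiLim_of_hnegK0`):

the first-order dictionary term of registry row E-022∣K₀ must be negative and at least `A·phiLim A u` in size
(times `1/A`) for the design to close — e.g. for «K₀-POS-001» `k₁ − k₃`: `A·phiLim = (A+1)(32πε − 16πε² + 64πε³)`,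
`ε = 1/(2A+1)` (`phiLim_k13`), the cell's «−16π threshold» (ls-ref-1 19:54:39Z, REF-B2 20:07:03Z) in exact form.
STATUS OF THE OBJECTS as in parts 6–8. One plumbing definition (`phiLim`); theorems otherwise.
-/

noncomputable section

open Real Complex ComplexConjugate MeasureTheory Set Filter Topology

namespace Literature.NumberTheory.LFunctions.Zhang2022

namespace EllRegime

open EllScales

/-- **The limit value of the `K₀` main term along the regime** (`D → ∞` at fixed `A`):
`phiLim A u = ((A+1)/A)·ellFormQ (A/(A+½)) (−u₀) u₁ (−u₂)` — `r*⁻¹·H(ℓ*r*)(v)` at the limit regime point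
`ℓ*r* = A/(A+½)`, `r* = A/(A+1)`. [cite: Zhang2022LandauSiegel, §2 (2.10), (2.13), (2.23)–(2.25), (2.30)] -/
def phiLim (A : ℝ) (u : Fin 3 → ℂ) : ℝ :=
  (A + 1) / A * Objective.ellFormQ (A / (A + 1 / 2)) (-u 0) (u 1) (-u 2)

/-- `ℓ ↦ ellFormQ ℓ x` is continuous (a cubic polynomial in `ℓ`). [cite: Zhang2022LandauSiegel, §2 (2.10), (2.13)] -/
theorem continuous_ellFormQ (x₁ x₂ x₃ : ℂ) : Continuous fun ℓ : ℝ => Objective.ellFormQ ℓ x₁ x₂ x₃ := by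
  unfold Objective.ellFormQ
  fun_prop

/-- Along the regime records, `ℓ(P)·(L_M/L_R) = Au/((A+½)u + 519 log u)` at `u = log D` (`D ≥ 2`).
[cite: Zhang2022LandauSiegel, §2 (2.6), (2.8), (2.10), (2.30)] -/
theorem ellP_mul_shrink_regimeRecord {A : ℝ} (hA : 0 < A) {D : ℕ} (hD : 7 ≤ D) :
    (regimeRecord A D).ellP * (regimeRecord A D).shrink =
      A * Real.log D / ((A + 1 / 2) * Real.log D + 519 * Real.log (Real.log D)) := by
  have hS := isEllRegimeP_regimeRecord A D
  have hD2 : 2 ≤ (regimeRecord A D).D := le_trans (by norm_num) hD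
  obtain ⟨hs0, -, -, -, -⟩ := hS.frame_bounds hA hD
  have hR : (regimeRecord A D).LRefl (regimeRecord A D).P ≠ 0 := by
    intro h0
    have : (regimeRecord A D).shrink = 0 := by unfold Scales.shrink; rw [h0, div_zero]
    linarith
  rw [(regimeRecord A D).ellP_mul_shrink hR, hS.LDelta_P hD2]
  rfl

/-- Along the regime records, `L_M/L_R = Au/((A+1)u + 519 log u − log 2π)` at `u = log D` (`D ≥ 2`).
[cite: Zhang2022LandauSiegel, §2 (2.6), (2.8), (2.30)] -/
theorem shrink_regimeRecord (A : ℝ) {D : ℕ} (hD : 2 ≤ D) :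
    (regimeRecord A D).shrink =
      A * Real.log D / ((A + 1) * Real.log D + 519 * Real.log (Real.log D) - Real.log (2 * π)) :=
  (isEllRegimeP_regimeRecord A D).shrink_eq hD

/-- **The `K₀` main term converges along the regime**: for `Σ u_j = 0` and `A > 0`,
`F_{ℓ(P)}(rescale (L_M/L_R) (expComb (1,2,3) u)) → phiLim A u` as `D → ∞` along `regimeRecord A D`.
[cite: Zhang2022LandauSiegel, §2 (2.10), (2.13), (2.23)–(2.25), (2.30)] -/
theorem tendsto_mainTerm_regimeRecord_k123 {u : Fin 3 → ℂ} (hu : ∑ j, u j = 0) {A : ℝ} (hA : 0 < A) :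
    Tendsto (fun D : ℕ => mainTermFormEll (regimeRecord A D).ellP
      (rescale (regimeRecord A D).shrink (expComb k123 u)) (rescale' (regimeRecord A D).shrink (expComb' k123 u)))
      atTop (𝓝 (phiLim A u)) := by
  -- the two ratios as functions of `w = log D`
  set fS : ℝ → ℝ := fun w => A * w / ((A + 1) * w + 519 * Real.log w - Real.log (2 * π)) with hfS
  set fE : ℝ → ℝ := fun w => ((A + 1) * w + 519 * Real.log w - Real.log (2 * π)) /
      ((A + 1 / 2) * w + 519 * Real.log w) with hfE
  have hlog : Tendsto (fun D : ℕ => Real.log (D : ℝ)) atTop atTop :=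
    Real.tendsto_log_atTop.comp tendsto_natCast_atTop_atTop
  have hS : Tendsto (fun D : ℕ => fS (Real.log D)) atTop (𝓝 (A / (A + 1))) :=
    (Scales.tendsto_shrinkRatio hA).comp hlog
  have hE : Tendsto (fun D : ℕ => fE (Real.log D)) atTop (𝓝 ((A + 1) / (A + 1 / 2))) :=
    (Scales.tendsto_ellRatio hA).comp hlog
  have hA1 : A / (A + 1) ≠ 0 := div_ne_zero hA.ne' (by linarith)
  -- the product ratio tends to `A/(A+½)`
  have hP : Tendsto (fun D : ℕ => fE (Real.log D) * fS (Real.log D)) atTop (𝓝 (A / (A + 1 / 2))) := by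
    have := hE.mul hS
    have e : (A + 1) / (A + 1 / 2) * (A / (A + 1)) = A / (A + 1 / 2) := by
      field_simp
    rwa [e] at this
  -- assemble the closed form `fS⁻¹ · ellFormQ (fE·fS) v`
  have hQ : Tendsto (fun D : ℕ => Objective.ellFormQ (fE (Real.log D) * fS (Real.log D)) (-u 0) (u 1) (-u 2))
      atTop (𝓝 (Objective.ellFormQ (A / (A + 1 / 2)) (-u 0) (u 1) (-u 2))) :=
    ((continuous_ellFormQ (-u 0) (u 1) (-u 2)).tendsto _).comp hP
  have hlim : Tendsto (fun D : ℕ => (fS (Real.log D))⁻¹ *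
      Objective.ellFormQ (fE (Real.log D) * fS (Real.log D)) (-u 0) (u 1) (-u 2)) atTop (𝓝 (phiLim A u)) := by
    have := (hS.inv₀ hA1).mul hQ
    have e : (A / (A + 1))⁻¹ = (A + 1) / A := by rw [inv_div]
    rw [e] at this
    exact this
  -- the closed form holds for `D ≥ 7`
  refine hlim.congr' ?_
  filter_upwards [eventually_ge_atTop 7] with D hD
  have hS7 := isEllRegimeP_regimeRecord A D
  obtain ⟨hs0, hs1, -, -, -⟩ := hS7.frame_bounds hA hD
  have hD2 : 2 ≤ D := le_trans (by norm_num) hD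
  rw [mainTermFormEll_rescale_expComb_k123 hu _ hs0 hs1]
  -- identify `shrink` and `ellP·shrink` with the ratios
  have e1 : (regimeRecord A D).shrink = fS (Real.log D) := shrink_regimeRecord A hD2
  have e2 : (regimeRecord A D).ellP * (regimeRecord A D).shrink = fE (Real.log D) * fS (Real.log D) := by
    rw [ellP_mul_shrink_regimeRecord hA hD, hfE, hfS]
    have hpos : 0 < (A + 1) * Real.log D + 519 * Real.log (Real.log D) - Real.log (2 * π) := by
      have h := (isEllRegimeP_regimeRecord A D).LRefl_P hD2
      have hR : 0 < (regimeRecord A D).LRefl (regimeRecord A D).P := by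
        have hD7 : (7 : ℝ) ≤ ((regimeRecord A D).D : ℕ) := by exact_mod_cast hD
        have hD0 : (0 : ℝ) < ((regimeRecord A D).D : ℕ) := by linarith
        have ht : 0 < (regimeRecord A D).t0 := by
          show 0 < Real.log ((regimeRecord A D).D : ℝ) ^ 519
          exact pow_pos (Real.log_pos (by linarith)) _
        rw [(regimeRecord A D).LRefl_P_eq hD0 ht]
        have hP : 0 < (regimeRecord A D).logP := by
          show 0 < A * Real.log ((regimeRecord A D).D : ℝ)
          exact mul_pos hA (Real.log_pos (by linarith))
        have h2π : Real.log (2 * π) < Real.log ((regimeRecord A D).D : ℝ) := by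
          apply Real.log_lt_log (by positivity)
          have := Real.pi_lt_d2
          linarith
        have ht1 : 0 ≤ Real.log (regimeRecord A D).t0 := by
          apply Real.log_nonneg
          show 1 ≤ Real.log ((regimeRecord A D).D : ℝ) ^ 519
          refine one_le_pow₀ ?_
          rw [← Real.exp_le_exp, Real.exp_log hD0]
          have := Real.exp_one_lt_d9
          linarith
        linarith
      rw [h] at hR
      exact hR
    have hD7 : (7 : ℝ) ≤ (D : ℝ) := by exact_mod_cast hD
    have hlogD : 1 < Real.log (D : ℝ) := by
      rw [← Real.exp_lt_exp, Real.exp_log (by linarith)]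
      have := Real.exp_one_lt_d9
      linarith
    have hloglog : 0 < Real.log (Real.log (D : ℝ)) := Real.log_pos hlogD
    have hden2 : (A + 1 / 2) * Real.log D + 519 * Real.log (Real.log D) ≠ 0 := by
      have : 0 < (A + 1 / 2) * Real.log D + 519 * Real.log (Real.log D) := by positivity
      exact this.ne'
    have hne1 := hpos.ne'
    simp only
    rw [div_mul_div_comm, div_eq_div_iff hden2 (mul_ne_zero hden2 hne1)]
    ring
  rw [e2, e1]

/-- **The kernel threshold for the first-order dictionary term.** For shifts `(1,2,3)`, a coefficient pattern
with `Σ u_j = 0` and `A > 0`: if the closing hypothesis `hneg` of `theorem1_of_ellDictK0` holds, then for every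
`|λ| ≤ Λ`, `(G₀ + λG₁)/A + K/A² ≤ −phiLim A u` — the dictionary term must be NEGATIVE and at least the (positive)
limit main term in size. [cite: Zhang2022LandauSiegel, §2 (2.10), (2.23)–(2.25), (2.30); §8 (8.23)] -/
theorem dict_le_neg_phiLim_of_hnegK0 {u : Fin 3 → ℂ} (hu : ∑ j, u j = 0) {A G₀ G₁ Λ K : ℝ} (hA : 0 < A)
    (hneg : ∃ D₁ : ℕ, ∀ S : Scales, D₁ ≤ S.D → S.IsEllRegimeP A → ∀ lam : ℝ, |lam| ≤ Λ →
      mainTermFormEll S.ellP (rescale S.shrink (expComb k123 u)) (rescale' S.shrink (expComb' k123 u))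
        + (G₀ + lam * G₁) / A + K / A ^ 2 < 0)
    {lam : ℝ} (hlam : |lam| ≤ Λ) : (G₀ + lam * G₁) / A + K / A ^ 2 ≤ -phiLim A u := by
  obtain ⟨D₁, hD₁⟩ := hneg
  have hT := tendsto_mainTerm_regimeRecord_k123 hu hA
  have hT' : Tendsto (fun D : ℕ => mainTermFormEll (regimeRecord A D).ellP
      (rescale (regimeRecord A D).shrink (expComb k123 u)) (rescale' (regimeRecord A D).shrink (expComb' k123 u))
      + ((G₀ + lam * G₁) / A + K / A ^ 2)) atTop (𝓝 (phiLim A u + ((G₀ + lam * G₁) / A + K / A ^ 2))) :=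
    hT.add_const _
  have hle : phiLim A u + ((G₀ + lam * G₁) / A + K / A ^ 2) ≤ 0 := by
    refine le_of_tendsto hT' ?_
    filter_upwards [eventually_ge_atTop D₁] with D hD
    have h := hD₁ (regimeRecord A D) hD (isEllRegimeP_regimeRecord A D) lam hlam
    linarith
  linarith

/-- `phiLim` is non-negative: it is a limit of non-negative main terms (part 7). [cite: Zhang2022LandauSiegel, §2 (2.10), (2.30)] -/
theorem phiLim_nonneg {u : Fin 3 → ℂ} (hu : ∑ j, u j = 0) {A : ℝ} (hA : 0 < A) : 0 ≤ phiLim A u := by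
  refine ge_of_tendsto (tendsto_mainTerm_regimeRecord_k123 hu hA) ?_
  filter_upwards [eventually_ge_atTop 7] with D hD
  exact mainTerm_frame_nonneg_expComb k123 hu (isEllRegimeP_regimeRecord A D) hA hD

/-- **«K₀-POS-001» threshold in closed form**: for `k₁ − k₃` (`u = (−1, 0, 1)`),
`phiLim A u = ((A+1)/A)·(32πε − 16πε² + 64πε³)` with `ε = 1/(2A+1)` (so `A·phiLim → 16π`).
[cite: Zhang2022LandauSiegel, §2 (2.10), (2.13), (2.23)–(2.25), (2.30)] -/
theorem phiLim_k13 {A : ℝ} (hA : 0 < A) :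
    phiLim A ![-1, 0, 1] =
      (A + 1) / A * (32 * π * (1 / (2 * A + 1)) - 16 * π * (1 / (2 * A + 1)) ^ 2
        + 64 * π * (1 / (2 * A + 1)) ^ 3) := by
  unfold phiLim
  congr 1
  have hA2 : 2 * A + 1 ≠ 0 := by linarith
  have hA3 : A + 1 / 2 ≠ 0 := by linarith
  simp [Objective.ellFormQ]
  field_simp
  ring

/-- «K₀-POS-002» `k₁ + k₂` (`u = (−1, 1, 0)`): `phiLim A u = ((A+1)/A)·8π(ε − 5ε² + 9ε³)`, `ε = 1/(2A+1)`.
[cite: Zhang2022LandauSiegel, §2 (2.10), (2.13), (2.23)–(2.25), (2.30)] -/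
theorem phiLim_k12 {A : ℝ} (hA : 0 < A) :
    phiLim A ![-1, 1, 0] =
      (A + 1) / A * (8 * π * ((1 / (2 * A + 1)) - 5 * (1 / (2 * A + 1)) ^ 2 + 9 * (1 / (2 * A + 1)) ^ 3)) := by
  unfold phiLim
  congr 1
  have hA2 : 2 * A + 1 ≠ 0 := by linarith
  have hA3 : A + 1 / 2 ≠ 0 := by linarith
  simp [Objective.ellFormQ]
  field_simp
  ring

/-- «K₀-POS-003» `k₂ + k₃` (`u = (0, 1, −1)`): `phiLim A u = ((A+1)/A)·8π(ε + 7ε² + 5ε³)`, `ε = 1/(2A+1)`.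
[cite: Zhang2022LandauSiegel, §2 (2.10), (2.13), (2.23)–(2.25), (2.30)] -/
theorem phiLim_k23 {A : ℝ} (hA : 0 < A) :
    phiLim A ![0, 1, -1] =
      (A + 1) / A * (8 * π * ((1 / (2 * A + 1)) + 7 * (1 / (2 * A + 1)) ^ 2 + 5 * (1 / (2 * A + 1)) ^ 3)) := by
  unfold phiLim
  congr 1
  have hA2 : 2 * A + 1 ≠ 0 := by linarith
  have hA3 : A + 1 / 2 ≠ 0 := by linarith
  simp [Objective.ellFormQ]
  field_simp
  ring

end EllRegime

end Literature.NumberTheory.LFunctions.Zhang2022
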